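/-
Copyright (c) 2026 the pub-hodgecm-mathlib formalisation cell (harness21).  Prover seat hodgecm-mathlib-F0P3a-p02 (g22): LH4-plan (g6) WORD #57 (M5-β) «MÖBIUS LITERAL»
(FINDING OF RECORD #3, census `F0/P3a/F0P3a-p02/g22/CENSUS-M5-inert-consumers.v1_1.md`): the `h2`-free twin of ★ `DepthZeroKappaTransferCayleyLiteral` (A-p12 (g21)); 2026-09-02.
-/
import Literature.NumberTheory.Rogawski1990.DepthZeroKappaTransferCayleyLiteral   -- ★ A1 (A-p12 (g21)): its 2-free §1 (`exists_congr_conj_diagonal_of_gram`, `mul_frame_eq_of_congr_conj_diagonal`) and its whole import cone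
import Literature.NumberTheory.Automorphic.SplitTorusOrderMoebiusShift             -- ★ p851719 (this seat, (M5-α)): `exists_wild_cayley_literal`
import HarnessLib

/-!
# The depth-zero κ-transfer, type (1): the MÖBIUS literal of a congruent element near `1`, and `n₀(t) = #Fix(t′)` — EVERY residue characteristic
# (Kottwitz 1986 §3; Rogawski 1990 §4.9; Serre V §2)

Topic `NumberTheory/Rogawski1990`; namespace `Literature.NumberTheory.Rogawski1990`.  THEOREMS ONLY (no definition, no instance, no notation, no named fact, no `sorry`);
kernel lane `--supports stmt-HodgeConjecture-24833`.  Cell `pub/hodgecm-mathlib` (D-0151), crux H413; half A line LH4 (dyadic pay-down leaf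
`Cruxes/H413/Lines/F0_P3c_DyadicPaydown.lean`, organ (D-UNR) PRINT by ruling D74′), mechanism M5 of census F0P3a-p06 (g17) `DUNR-H2-CENSUS`; LH4-plan (g6) WORD #57 (M5-β).

WHAT.  ★ `exists_cayley_literal_of_congr_conj_diagonal` (FILE B of the ROW-0-per-literal road of the (P-1) assembly) carries `h2 : IsUnit (2 : 𝒪[L_w])` for ONE reason: the
Cayley transform `Y = (1+Z)(1−Z)⁻¹` is the Möbius image of `X = ϖ⁻¹(t−1)` under `((1+ϖ, 2),(ϖ−1, 2))`, determinant `4`, so `𝒪[X] = 𝒪[Y]` needs `2 ∈ 𝒪^×`.  THIS FILE proves the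
same statement WITHOUT `h2`, at every inert UNRAMIFIED place (`v ∣ 2` allowed): the literal is the unit-determinant Möbius image `Y_i = (X_i + a)∕(σa + (ϖσa − 1)X_i)` with the
TRACE-ONE element `a` of ★ `UnramifiedLocalConjDatum` (★ `unramifiedLocalConjDatum_adicCompletion`), whose scalar facts are ★ p851719 `exists_wild_cayley_literal` (norm one,
same order, `Y⁻¹` in the order, root distances kept — i.e. lowered by one from `x`); the eigenframe ∕ literal ∕ finiteness ∕ ★ ROW-0 steps are the ★ proof VERBATIM.
* **`exists_moebius_literal_of_congr_conj_diagonal`** — ★ A1's statement with the binder `h2` DELETED.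
CONSUMERS (undealt): the `h2`-free twins of ★ `DepthZeroKappaTransferTypeOneRowZero` (A2∕A3; still blocked by M1 = Flicker's `e = ½` literals) and the 15 threaded heads of the census
TABLE B.  HONEST LABEL: HC_CM is proved only modulo the 7 printed citations (2 remaining: hLiu418 = stmt-HodgeConjecture-24832, h413 = stmt-HodgeConjecture-24833) until rung 0
closes; count-neutral, (D-UNR) stays PRINT; pays no organ, opens no road.

## References
* [Kottwitz1986] R. E. Kottwitz, *Base change for unit elements of Hecke algebras*, Compositio Math. 60 (1986), §3 (the level recursion, all residue characteristics).
* [Rogawski1990] J. D. Rogawski, *Automorphic Representations of Unitary Groups in Three Variables* (1990), §4.9 p. 54, Prop. 4.9.1 (b) p. 55.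
* [SerreLocalFields1979] J.-P. Serre, *Local Fields* (1979), Ch. V §2 Prop. 3 (trace surjective in unramified extensions), §3; Ch. III §6.
* [Flicker1998UnitaryFL] Y. Z. Flicker, *Elementary proof of the fundamental lemma for a unitary group*, Canad. J. Math. 50 (1998), §2 Prop. 3 p. 78.
-/

set_option autoImplicit false

noncomputable section

open MeasureTheory Measure Set Function NumberField IsDedekindDomain Matrix Polynomial
open Literature.NumberTheory.Automorphic Literature.NumberTheory.Automorphic.UnitaryGroup
open Literature.NumberTheory.Automorphic.IntegralReduction Literature.NumberTheory.GaloisRepresentations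
open Literature.NumberTheory.Automorphic.HermitianLattice (unitaryInt LocalConjDatum UnramifiedLocalConjDatum)
open scoped Matrix MatrixGroups ValuativeRel

namespace Literature.NumberTheory.Rogawski1990

/-! ## The core: the Möbius literal of a congruent element near `1` and `n₀(t) = #Fix(t′)` -/

section Core

variable (L : Type) [Field L] [NumberField L] [IsCMField L] (H' : Matrix (Fin 3) (Fin 3) L)
  {v : HeightOneSpectrum (𝓞 ↥(maximalRealSubfield L))}

set_option synthInstance.maxHeartbeats 200000 in  -- the coset actions `U_w ↷ U_w ⧸ unitaryInt`, `G′_v ↷ G′_v ⧸ K_v` (as in ★ `FixedCosetsTransport`)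
set_option maxHeartbeats 800000 in  -- one long assembly proof over the heavy one-place carriers
open scoped Classical in
/-- **THE MÖBIUS LITERAL (core of ROW 0 at EVERY residue characteristic)** — the `h2`-free twin of ★ `exists_cayley_literal_of_congr_conj_diagonal`: for `t ∈ G′_v`
congruent to `P₁·diag(x₁,x₂,x₃)·P₁⁻¹` (`P₁` a frame with diagonal `Φ₃`-Gram matrix; `x_i` norm one, pairwise distinct, `≡ 1 (mod 𝔪_w)`, at distances `P, Q₁, Q₂`) at an
UNRAMIFIED inert `v` — `v ∣ 2` ALLOWED —, there are norm-one `Y₁, Y₂, Y₃ ∈ E_v` and `t′ ∈ G′_v` congruent to `P₁·diag(Y)·P₁⁻¹` with distances `P − 1, Q₁ − 1, Q₂ − 1` at `w`,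
finitely many `t′`-fixed cosets in the one-place model, and `n₀(t) = #{q ∈ U(σ_w, Φ₃)(L_w) ⧸ unitaryInt : (ψ t′)_w • q = q}`.  The literal is the unit-determinant MÖBIUS image
`Y_i = (X_i + a)∕(σa + (ϖσa − 1)X_i)`, `X_i = ϖ⁻¹(x_i − 1)`, `a + σa = 1` the trace element of ★ `UnramifiedLocalConjDatum` (★ p851719 `exists_wild_cayley_literal`: norm one,
SAME ORDER `𝒪_w[X] = 𝒪_w[Y]`, `Y⁻¹ ∈ 𝒪_w[Y]`, `|Y_i − Y_j| = |X_i − X_j|`) — replacing the Cayley transform, whose determinant `4` needs `|2|_w = 1`; steps (4)–(7) of the ★ proof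
(eigenframe, literal, finiteness, ★ ROW-0 = `#Fix`, ★ `natCard_fixedCosets_eq`, ★ `natCard_fixedBy_cmLocalIntegralLevel_eq_of_congr`) are VERBATIM.
[cite: Kottwitz1986, §3] [cite: Rogawski1990, §4.9 p. 54, Prop. 4.9.1 (b) p. 55] [cite: SerreLocalFields1979, Ch. V §2 Prop. 3] -/
theorem exists_moebius_literal_of_congr_conj_diagonal
    (hH' : (H'.map (IsCMField.complexConj L))ᵀ = H') (hH'u : IsUnit H') (w : PlacesOver L v)
    (hw : IsCMField.complexConj L • w.1 = w.1) (hv : Algebra.IsUnramifiedIn (𝓞 L) v.asIdeal)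
    {x₁ x₂ x₃ : LocalRing L v}
    (hx₁ : conjLocal L (IsCMField.complexConj L) v x₁ * x₁ = 1) (hx₂ : conjLocal L (IsCMField.complexConj L) v x₂ * x₂ = 1)
    (hx₃ : conjLocal L (IsCMField.complexConj L) v x₃ * x₃ = 1)
    (Tl : GL (Fin 3) (LocalRing L v))
    (ψ : ↥(UnitaryGroup.«local» L (IsCMField.complexConj L) 3 H' v) ≃ₜ*
        ↥(UnitaryGroup.«local» L (IsCMField.complexConj L) 3 (Matrix.of fun i j : Fin 3 => if i.val + j.val + 1 = 3 then (1 : L) else 0) v))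
    (t : (cmDatum L 3 H').Local v)
    (hψ : ∀ g, (ψ g).val = Tl * g.val * Tl⁻¹)
    (hlev : ∀ g, g ∈ cmLocalIntegralLevel L 3 H' v ↔
        ψ g ∈ cmLocalIntegralLevel L 3 (Matrix.of fun i j : Fin 3 => if i.val + j.val + 1 = 3 then (1 : L) else 0) v)
    (P₁ : GL (Fin 3) (LocalRing L v)) {d : Fin 3 → LocalRing L v}
    (hG : ((P₁.val : Matrix (Fin 3) (Fin 3) (LocalRing L v)).map (conjLocal L (IsCMField.complexConj L) v))ᵀ *
        (Matrix.of fun i j : Fin 3 => if i.val + j.val + 1 = 3 then (1 : LocalRing L v) else 0) * P₁.val = diagonal d)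
    (hlit : (ψ t).val.val = P₁.val * diagonal ![x₁, x₂, x₃] * (P₁⁻¹).val)
    {P Q₁ Q₂ : ℕ} (hP : Valued.v (x₁ w - x₃ w) = WithZero.exp (-(P : ℤ))) (hQ₁ : Valued.v (x₁ w - x₂ w) = WithZero.exp (-(Q₁ : ℤ)))
    (hQ₂ : Valued.v (x₃ w - x₂ w) = WithZero.exp (-(Q₂ : ℤ)))
    (hd₁ : Valued.v (x₁ w - 1) < 1) (hd₂ : Valued.v (x₂ w - 1) < 1) (hd₃ : Valued.v (x₃ w - 1) < 1) :
    ∃ (Y₁ Y₂ Y₃ : LocalRing L v) (t' : (cmDatum L 3 H').Local v),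
      (ψ t').val.val = P₁.val * diagonal ![Y₁, Y₂, Y₃] * (P₁⁻¹).val ∧
      galAdicCompletionMap (L := L) (IsCMField.complexConj L) hw (Y₁ w) * Y₁ w = 1 ∧
      galAdicCompletionMap (L := L) (IsCMField.complexConj L) hw (Y₂ w) * Y₂ w = 1 ∧
      galAdicCompletionMap (L := L) (IsCMField.complexConj L) hw (Y₃ w) * Y₃ w = 1 ∧
      Valued.v (Y₁ w - Y₃ w) = WithZero.exp (-((P - 1 : ℕ) : ℤ)) ∧ Valued.v (Y₁ w - Y₂ w) = WithZero.exp (-((Q₁ - 1 : ℕ) : ℤ)) ∧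
      Valued.v (Y₃ w - Y₂ w) = WithZero.exp (-((Q₂ - 1 : ℕ) : ℤ)) ∧
      {q : ↥(unitaryGroupOfForm (galAdicCompletionMap (L := L) (IsCMField.complexConj L) hw)
          (placeForm (Matrix.of fun i j : Fin 3 => if i.val + j.val + 1 = 3 then (1 : L) else 0) w.1)) ⧸
        unitaryInt (galAdicCompletionMap (L := L) (IsCMField.complexConj L) hw)
          (placeForm (Matrix.of fun i j : Fin 3 => if i.val + j.val + 1 = 3 then (1 : L) else 0) w.1) |
        localNonsplitEquiv (IsCMField.complexConj L) (Matrix.of fun i j : Fin 3 => if i.val + j.val + 1 = 3 then (1 : L) else 0)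
          (IsCMField.complexConj_ne_one L) w hw (ψ t') • q = q}.Finite ∧
      {q : (cmDatum L 3 H').Local v ⧸ cmLocalIntegralLevel L 3 H' v |
        q ∈ MulAction.fixedBy ((cmDatum L 3 H').Local v ⧸ cmLocalIntegralLevel L 3 H' v) t ∧
          (redMat ((((q.out⁻¹ * t * q.out : (cmDatum L 3 H').Local v)).val : GL (Fin 3) (LocalRing L v)).val.map
            (Pi.evalRingHom (fun w' : PlacesOver L v => w'.1.adicCompletion L) w)) - 1).rank = 0}.ncard =
      Nat.card {q : ↥(unitaryGroupOfForm (galAdicCompletionMap (L := L) (IsCMField.complexConj L) hw)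
          (placeForm (Matrix.of fun i j : Fin 3 => if i.val + j.val + 1 = 3 then (1 : L) else 0) w.1)) ⧸
        unitaryInt (galAdicCompletionMap (L := L) (IsCMField.complexConj L) hw)
          (placeForm (Matrix.of fun i j : Fin 3 => if i.val + j.val + 1 = 3 then (1 : L) else 0) w.1) |
        localNonsplitEquiv (IsCMField.complexConj L) (Matrix.of fun i j : Fin 3 => if i.val + j.val + 1 = 3 then (1 : L) else 0)
          (IsCMField.complexConj_ne_one L) w hw (ψ t') • q = q} := by
  have hc1 : IsCMField.complexConj L ≠ 1 := IsCMField.complexConj_ne_one L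
  haveI : Algebra.IsQuadraticExtension ↥(maximalRealSubfield L) L := IsCMField.isQuadraticExtension L
  haveI : Subsingleton (PlacesOver L v) := PlacesOver.subsingleton_of_smul_eq (IsCMField.complexConj L) hc1 w hw
  letI : Unique (PlacesOver L v) := uniqueOfSubsingleton w
  let πe : LocalRing L v ≃+* w.1.adicCompletion L := RingEquiv.piUnique fun w' : PlacesOver L v => w'.1.adicCompletion L
  have hπe : ∀ z : w.1.adicCompletion L, πe.symm z w = z := fun z => πe.apply_symm_apply z
  have hπe' : ∀ z : LocalRing L v, πe z = z w := fun z => rfl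
  -- (0) `H′` hermitian invertible; `σ` at `w`; `2 ∉ v`
  have hH'c : (H'.map (cmConjRingHom L))ᵀ = H' := by
    have e1 : H'.map (cmConjRingHom L) = H'.map (IsCMField.complexConj L) := by
      ext i j; simp [Matrix.map_apply, cmConjRingHom_apply]
    rw [e1]; exact hH'
  have hdet : H'.det ≠ 0 := (Matrix.isUnit_iff_isUnit_det _ |>.1 hH'u).ne_zero
  have hσw : ∀ z : LocalRing L v, conjLocal L (IsCMField.complexConj L) v z w = galAdicCompletionMap (L := L) (IsCMField.complexConj L) hw (z w) :=
    fun z => conjLocal_apply_eq_of_smul_eq (IsCMField.complexConj L) hc1 v w hw z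
  have hx₁w : galAdicCompletionMap (L := L) (IsCMField.complexConj L) hw (x₁ w) * x₁ w = 1 := by rw [← hσw]; exact (congrFun hx₁ w : _)
  have hx₂w : galAdicCompletionMap (L := L) (IsCMField.complexConj L) hw (x₂ w) * x₂ w = 1 := by rw [← hσw]; exact (congrFun hx₂ w : _)
  have hx₃w : galAdicCompletionMap (L := L) (IsCMField.complexConj L) hw (x₃ w) * x₃ w = 1 := by rw [← hσw]; exact (congrFun hx₃ w : _)
  -- (1) the `σ_w`-fixed uniformiser `ϖ` and the two valuation currencies
  obtain ⟨ϖ, hdϖ⟩ := unramifiedLocalConjDatum_adicCompletion (IsCMField.complexConj L) hc1 v w hw hv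
  obtain ⟨a, haO, ha⟩ := hdϖ.trace
  have hϖU : IsUniformizingElement ϖ := isUniformizingElement_of_valued_eq L w.1 hdϖ.vϖ
  have hϖ0 : ϖ ≠ 0 := hϖU.ne_zero
  have hiso := ValuativeRel.isEquiv (ValuativeRel.valuation (w.1.adicCompletion L)) (Valued.v : Valuation (w.1.adicCompletion L) (WithZero (Multiplicative ℤ)))
  have hmemO : ∀ {z : w.1.adicCompletion L}, Valued.v z ≤ 1 → z ∈ 𝒪[w.1.adicCompletion L] :=
    fun hz => (Valuation.mem_integer_iff _ _).2 (hiso.le_one_iff_le_one.2 hz)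
  have hmemO' : ∀ {z : w.1.adicCompletion L}, z ∈ 𝒪[w.1.adicCompletion L] → Valued.v z ≤ 1 :=
    fun hz => hiso.le_one_iff_le_one.1 ((Valuation.mem_integer_iff _ _).1 hz)
  have hϖ1 : Valued.v ϖ < 1 := by rw [hdϖ.vϖ, ← WithZero.exp_zero, WithZero.exp_lt_exp]; norm_num
  -- (2) the scalar Cayley data at `w`
  have hxw : ∀ i, Valued.v ((![x₁ w, x₂ w, x₃ w] : Fin 3 → w.1.adicCompletion L) i - 1) < 1 := by
    intro i; fin_cases i
    · exact hd₁
    · exact hd₂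
    · exact hd₃
  have hxn : ∀ i, galAdicCompletionMap (L := L) (IsCMField.complexConj L) hw ((![x₁ w, x₂ w, x₃ w] : Fin 3 → w.1.adicCompletion L) i) *
      (![x₁ w, x₂ w, x₃ w] : Fin 3 → w.1.adicCompletion L) i = 1 := by
    intro i; fin_cases i
    · exact hx₁w
    · exact hx₂w
    · exact hx₃w
  -- the shifted parameters `X_i = ϖ⁻¹(x_i − 1) ∈ 𝒪_w`, `x_i = 1 + ϖ X_i` norm one
  have huO : ∀ i, ϖ⁻¹ * ((![x₁ w, x₂ w, x₃ w] : Fin 3 → w.1.adicCompletion L) i - 1) ∈ 𝒪[w.1.adicCompletion L] :=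
    fun i => hmemO (valued_shift_le_one hdϖ.vϖ (hxw i))
  have hxX : ∀ i, (![x₁ w, x₂ w, x₃ w] : Fin 3 → w.1.adicCompletion L) i = 1 + ϖ * (ϖ⁻¹ * ((![x₁ w, x₂ w, x₃ w] : Fin 3 → w.1.adicCompletion L) i - 1)) :=
    fun i => by rw [mul_inv_cancel_left₀ hϖ0]; ring
  have hNX : ∀ i, galAdicCompletionMap (L := L) (IsCMField.complexConj L) hw (1 + ϖ * (ϖ⁻¹ * ((![x₁ w, x₂ w, x₃ w] : Fin 3 → w.1.adicCompletion L) i - 1))) *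
      (1 + ϖ * (ϖ⁻¹ * ((![x₁ w, x₂ w, x₃ w] : Fin 3 → w.1.adicCompletion L) i - 1))) = 1 := fun i => by rw [← hxX i]; exact hxn i
  -- ★ p851719: the WILD CAYLEY (MÖBIUS) LITERAL SCALARS `Yf i := (X_i + a)∕(σa + (ϖσa − 1)X_i)`
  obtain ⟨hYnX, hspanX, hYinvX, hYsubX⟩ := exists_wild_cayley_literal (𝒪[w.1.adicCompletion L]) (galAdicCompletionMap (L := L) (IsCMField.complexConj L) hw)
    (fun z hz => hmemO hz) (fun z hz => hmemO' hz) hdϖ.σσ hdϖ.vσ hϖ1 hϖ0 hdϖ.σϖ ha haO huO hNX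
  obtain ⟨Yf, hYf⟩ : ∃ Yf : Fin 3 → w.1.adicCompletion L, Yf = fun i =>
    (ϖ⁻¹ * ((![x₁ w, x₂ w, x₃ w] : Fin 3 → w.1.adicCompletion L) i - 1) + a) /
      (galAdicCompletionMap (L := L) (IsCMField.complexConj L) hw a +
        (ϖ * galAdicCompletionMap (L := L) (IsCMField.complexConj L) hw a - 1) * (ϖ⁻¹ * ((![x₁ w, x₂ w, x₃ w] : Fin 3 → w.1.adicCompletion L) i - 1))) := ⟨_, rfl⟩
  have hYfi : ∀ i, Yf i = (ϖ⁻¹ * ((![x₁ w, x₂ w, x₃ w] : Fin 3 → w.1.adicCompletion L) i - 1) + a) /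
      (galAdicCompletionMap (L := L) (IsCMField.complexConj L) hw a +
        (ϖ * galAdicCompletionMap (L := L) (IsCMField.complexConj L) hw a - 1) * (ϖ⁻¹ * ((![x₁ w, x₂ w, x₃ w] : Fin 3 → w.1.adicCompletion L) i - 1))) :=
    fun i => by rw [hYf]
  have hYn : ∀ i, galAdicCompletionMap (L := L) (IsCMField.complexConj L) hw (Yf i) * Yf i = 1 := fun i => by rw [hYfi]; exact hYnX i
  have hY0 : ∀ i, Yf i ≠ 0 := fun i h0 => by have := hYn i; rw [h0, mul_zero] at this; exact zero_ne_one this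
  have hYsub : ∀ i j, Valued.v (Yf i - Yf j) = Valued.v ((![x₁ w, x₂ w, x₃ w] : Fin 3 → w.1.adicCompletion L) i - (![x₁ w, x₂ w, x₃ w] : Fin 3 → w.1.adicCompletion L) j) /
      Valued.v ϖ := fun i j => by
    rw [hYfi, hYfi, hYsubX i j, ← mul_sub, show (![x₁ w, x₂ w, x₃ w] : Fin 3 → w.1.adicCompletion L) i - 1 - ((![x₁ w, x₂ w, x₃ w] : Fin 3 → w.1.adicCompletion L) j - 1) =
      (![x₁ w, x₂ w, x₃ w] : Fin 3 → w.1.adicCompletion L) i - (![x₁ w, x₂ w, x₃ w] : Fin 3 → w.1.adicCompletion L) j by ring, map_mul, map_inv₀, mul_comm, div_eq_mul_inv]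
  obtain ⟨Yv, hYv⟩ : ∃ Yv : Fin 3 → LocalRing L v, Yv = fun i => πe.symm (Yf i) := ⟨_, rfl⟩
  have hYvw : ∀ i, Yv i w = Yf i := fun i => by rw [hYv]; exact hπe (Yf i)
  have hYvn : ∀ i, conjLocal L (IsCMField.complexConj L) v (Yv i) * Yv i = 1 := by
    intro i
    apply πe.injective
    rw [map_mul, map_one, hπe', hπe', hσw, hYvw]
    exact hYn i
  have hYvinj : Function.Injective ![Yv 0, Yv 1, Yv 2] := by
    have hne : ∀ i j, (![x₁ w, x₂ w, x₃ w] : Fin 3 → w.1.adicCompletion L) i ≠ (![x₁ w, x₂ w, x₃ w] : Fin 3 → w.1.adicCompletion L) j → Yv i ≠ Yv j := by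
      intro i j hij hY
      have hY' : Yf i = Yf j := by rw [← hYvw, ← hYvw, hY]
      have h := hYsub i j
      rw [hY', sub_self, map_zero, eq_comm, div_eq_zero_iff, map_eq_zero, map_eq_zero, sub_eq_zero] at h
      exact h.elim hij hϖ0
    have h12 : x₁ w ≠ x₂ w := fun h => by have := hQ₁; rw [h, sub_self, map_zero] at this; exact WithZero.exp_ne_zero this.symm
    have h13 : x₁ w ≠ x₃ w := fun h => by have := hP; rw [h, sub_self, map_zero] at this; exact WithZero.exp_ne_zero this.symm
    have h32 : x₃ w ≠ x₂ w := fun h => by have := hQ₂; rw [h, sub_self, map_zero] at this; exact WithZero.exp_ne_zero this.symm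
    intro i j hij
    fin_cases i <;> fin_cases j
    all_goals first | rfl | (exfalso; revert hij; simp only [imp_false, ← ne_eq])
    exacts [hne 0 1 h12, hne 0 2 h13, (hne 0 1 h12).symm, hne 1 2 h32.symm, (hne 0 2 h13).symm, (hne 1 2 h32.symm).symm]
  -- (3) the Cayley literal `t′` and the common eigenframe `Q = Tl⁻¹ P₁`
  have hYv3 : (![Yv 0, Yv 1, Yv 2] : Fin 3 → LocalRing L v) = Yv := by funext i; fin_cases i <;> rfl
  obtain ⟨t', hlit', hQ'⟩ := exists_congr_conj_diagonal_of_gram L H' Tl ψ hψ P₁ hG (Y := ![Yv 0, Yv 1, Yv 2]) (fun i => by rw [hYv3]; exact hYvn i)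
  have hQ := mul_frame_eq_of_congr_conj_diagonal L H' Tl ψ hψ t P₁ hlit
  -- (4) `t′` is regular elliptic: finitely many fixed cosets
  have hreg' : IsRegularElt (t'.val : GL (Fin 3) (LocalRing L v)) := isRegularElt_of_eigenframe L H' w hw t' hQ' hYvinj
  haveI : CompactSpace (Subgroup.centralizer ({t'} : Set ((cmDatum L 3 H').Local v))) :=
    compactSpace_centralizer_of_eigenframe_of_smul_eq L w hw H' hH'c hdet t' hQ' hYvinj (fun i => by rw [hYv3]; exact hYvn i)
  have hfinG : (MulAction.fixedBy ((cmDatum L 3 H').Local v ⧸ cmLocalIntegralLevel L 3 H' v) t').Finite :=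
    finite_fixedBy_quotient_of_isClosed t' (cmLocalIntegralLevel L 3 H' v) (isClosed_conjClass_local_of_isRegularElt L 3 H' v hH'c hdet t' hreg')
      (isCompact_isOpen_cmLocalIntegralLevel L 3 H' v).2 (isCompact_isOpen_cmLocalIntegralLevel L 3 H' v).1
  have hfin := (finite_fixedBy_cmLocalIntegralLevel_iff_of_congr L H' w hw ψ hlev t').1 hfinG
  -- (5) the frames read at `w`
  set f := Pi.evalRingHom (fun w' : PlacesOver L v => w'.1.adicCompletion L) w with hf
  set Qw : GL (Fin 3) (w.1.adicCompletion L) := Matrix.GeneralLinearGroup.map f (Tl⁻¹ * P₁) with hQw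
  have hQwval : (Qw : Matrix (Fin 3) (Fin 3) (w.1.adicCompletion L)) = ((Tl⁻¹ * P₁).val : Matrix (Fin 3) (Fin 3) (LocalRing L v)).map f := rfl
  have hQQ : (Qw : Matrix (Fin 3) (Fin 3) (w.1.adicCompletion L)) * ((Qw⁻¹ : GL (Fin 3) (w.1.adicCompletion L)) : Matrix (Fin 3) (Fin 3) (w.1.adicCompletion L)) = 1 := by
    rw [← Units.val_mul, mul_inv_cancel, Units.val_one]
  have hframe : ∀ (u : (cmDatum L 3 H').Local v) (z : Fin 3 → LocalRing L v),
      (u.val.val : Matrix (Fin 3) (Fin 3) (LocalRing L v)) * (Tl⁻¹ * P₁).val = (Tl⁻¹ * P₁).val * diagonal z →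
      (((localNonsplitEquiv (IsCMField.complexConj L) H' hc1 w hw u :
          unitaryGroupOfForm (galAdicCompletionMap (L := L) (IsCMField.complexConj L) hw) (placeForm H' w.1)) :
          GL (Fin 3) (w.1.adicCompletion L)) : Matrix (Fin 3) (Fin 3) (w.1.adicCompletion L)) =
        (Qw : Matrix (Fin 3) (Fin 3) (w.1.adicCompletion L)) * diagonal (fun i => z i w) * ((Qw⁻¹ : GL (Fin 3) (w.1.adicCompletion L)) : Matrix (Fin 3) (Fin 3) (w.1.adicCompletion L)) := by
    intro u z hu
    have h := congrArg (fun M : Matrix (Fin 3) (Fin 3) (LocalRing L v) => M.map f) hu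
    simp only [Matrix.map_mul, diagonal_map (map_zero f)] at h
    have e0 : (((localNonsplitEquiv (IsCMField.complexConj L) H' hc1 w hw u :
          unitaryGroupOfForm (galAdicCompletionMap (L := L) (IsCMField.complexConj L) hw) (placeForm H' w.1)) :
          GL (Fin 3) (w.1.adicCompletion L)) : Matrix (Fin 3) (Fin 3) (w.1.adicCompletion L)) = (u.val.val : Matrix (Fin 3) (Fin 3) (LocalRing L v)).map f :=
      coe_coe_localNonsplitEquiv_apply (c := IsCMField.complexConj L) (N := 3) (J := H') (hc := hc1) (w := w) (hw := hw) (g := u)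
    rw [e0]
    calc (u.val.val : Matrix (Fin 3) (Fin 3) (LocalRing L v)).map f
          = (u.val.val : Matrix (Fin 3) (Fin 3) (LocalRing L v)).map f *
              ((Qw : Matrix (Fin 3) (Fin 3) (w.1.adicCompletion L)) * ((Qw⁻¹ : GL (Fin 3) (w.1.adicCompletion L)) : Matrix (Fin 3) (Fin 3) (w.1.adicCompletion L))) := by
            rw [hQQ, Matrix.mul_one]
      _ = ((u.val.val : Matrix (Fin 3) (Fin 3) (LocalRing L v)).map f * (Qw : Matrix (Fin 3) (Fin 3) (w.1.adicCompletion L))) *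
              ((Qw⁻¹ : GL (Fin 3) (w.1.adicCompletion L)) : Matrix (Fin 3) (Fin 3) (w.1.adicCompletion L)) := by rw [Matrix.mul_assoc]
      _ = (Qw : Matrix (Fin 3) (Fin 3) (w.1.adicCompletion L)) * diagonal (fun i => z i w) *
              ((Qw⁻¹ : GL (Fin 3) (w.1.adicCompletion L)) : Matrix (Fin 3) (Fin 3) (w.1.adicCompletion L)) := by rw [hQwval, h]; rfl
  have htw := hframe t ![x₁, x₂, x₃] hQ
  have ht'w := hframe t' ![Yv 0, Yv 1, Yv 2] hQ'
  have hxvec : (fun i => (![x₁, x₂, x₃] : Fin 3 → LocalRing L v) i w) = (![x₁ w, x₂ w, x₃ w] : Fin 3 → w.1.adicCompletion L) := by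
    funext i; fin_cases i <;> rfl
  have hYvec : (fun i => (![Yv 0, Yv 1, Yv 2] : Fin 3 → LocalRing L v) i w) = Yf := by
    funext i; fin_cases i
    · exact hYvw 0
    · exact hYvw 1
    · exact hYvw 2
  rw [hxvec] at htw
  rw [hYvec] at ht'w
  -- (6) the shifted order: `X = 1 + ϖ⁻¹(t_w − 1)`, `Y_w`, `Y_w⁻¹` in the common eigenframe `Q_w`
  have hspan : Submodule.span 𝒪[w.1.adicCompletion L]
        (Set.range fun j : Fin 3 => fun i => (1 + ϖ⁻¹ * ((![x₁ w, x₂ w, x₃ w] : Fin 3 → w.1.adicCompletion L) i - 1)) ^ (j : ℕ)) =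
      Submodule.span 𝒪[w.1.adicCompletion L] (Set.range fun j : Fin 3 => fun i => Yf i ^ (j : ℕ)) := by
    rw [span_pow_one_add_eq _ huO, hspanX, hYf]
  have hYmem : Yf ∈ Submodule.span 𝒪[w.1.adicCompletion L] (Set.range fun j : Fin 3 => fun i => Yf i ^ (j : ℕ)) :=
    Submodule.subset_span ⟨1, funext fun i => by simp⟩
  have hsmem : (fun i => 1 + ϖ⁻¹ * ((![x₁ w, x₂ w, x₃ w] : Fin 3 → w.1.adicCompletion L) i - 1)) ∈ Submodule.span 𝒪[w.1.adicCompletion L]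
      (Set.range fun j : Fin 3 => fun i => (1 + ϖ⁻¹ * ((![x₁ w, x₂ w, x₃ w] : Fin 3 → w.1.adicCompletion L) i - 1)) ^ (j : ℕ)) :=
    Submodule.subset_span ⟨1, funext fun i => by simp⟩
  have hYinv : Yf⁻¹ ∈ Submodule.span 𝒪[w.1.adicCompletion L] (Set.range fun j : Fin 3 => fun i => Yf i ^ (j : ℕ)) := by
    rw [hYf]; exact hYinvX
  have hX_eq : 1 + ϖ⁻¹ • ((((localNonsplitEquiv (IsCMField.complexConj L) H' hc1 w hw t :
        unitaryGroupOfForm (galAdicCompletionMap (L := L) (IsCMField.complexConj L) hw) (placeForm H' w.1)) :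
          GL (Fin 3) (w.1.adicCompletion L)) : Matrix (Fin 3) (Fin 3) (w.1.adicCompletion L)) - 1) =
      (Qw : Matrix (Fin 3) (Fin 3) (w.1.adicCompletion L)) * diagonal (fun i => 1 + ϖ⁻¹ * ((![x₁ w, x₂ w, x₃ w] : Fin 3 → w.1.adicCompletion L) i - 1)) *
        ((Qw⁻¹ : GL (Fin 3) (w.1.adicCompletion L)) : Matrix (Fin 3) (Fin 3) (w.1.adicCompletion L)) := by
    rw [htw, conj_diagonal_one_add_mul_sub_one]
  have hYinv_eq : ((((localNonsplitEquiv (IsCMField.complexConj L) H' hc1 w hw t' :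
        unitaryGroupOfForm (galAdicCompletionMap (L := L) (IsCMField.complexConj L) hw) (placeForm H' w.1)) :
          GL (Fin 3) (w.1.adicCompletion L))⁻¹ : GL (Fin 3) (w.1.adicCompletion L)) : Matrix (Fin 3) (Fin 3) (w.1.adicCompletion L)) =
      (Qw : Matrix (Fin 3) (Fin 3) (w.1.adicCompletion L)) * diagonal Yf⁻¹ * ((Qw⁻¹ : GL (Fin 3) (w.1.adicCompletion L)) : Matrix (Fin 3) (Fin 3) (w.1.adicCompletion L)) := by
    rw [Matrix.coe_units_inv, ht'w, inv_conj_diagonal Qw hY0]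
  -- (7) ROW 0 = #Fix(t′): ★ p846223 (`Y := (t′)_w`; `Y, Y⁻¹ ∈ 𝒪_w[X]`, `X ∈ 𝒪_w[Y]` by the matrix bridge), then back to `G′_v ⧸ K_v` and over to the `Φ₃`-model
  have hJw : IsUnit (placeForm H' w.1) := isUnit_placeForm_of_isUnit_det ((Matrix.isUnit_iff_isUnit_det _).1 hH'u) w.1
  have h0 := ncard_fixedBy_rankStratum_zero_eq_natCard_fixedBy_of_mem_adjoin L 3 H' v w hw hJw hϖU t
    (localNonsplitEquiv (IsCMField.complexConj L) H' hc1 w hw t')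
    (by rw [ht'w, hX_eq]; exact conj_diagonal_mem_adjoin_of_mem_span_pow _ Qw (by rw [hspan]; exact hYmem))
    (by rw [hYinv_eq, hX_eq]; exact conj_diagonal_mem_adjoin_of_mem_span_pow _ Qw (by rw [hspan]; exact hYinv))
    (by rw [ht'w, hX_eq]; exact conj_diagonal_mem_adjoin_of_mem_span_pow _ Qw (by rw [← hspan]; exact hsmem))
  have hK : ∀ g : (cmDatum L 3 H').Local v, g ∈ cmLocalIntegralLevel L 3 H' v ↔
      (localNonsplitEquiv (IsCMField.complexConj L) H' hc1 w hw).toMulEquiv g ∈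
        (glInt 3 (w.1.adicCompletion L)).subgroupOf (unitaryGroupOfForm (galAdicCompletionMap (L := L) (IsCMField.complexConj L) hw) (placeForm H' w.1)) :=
    fun g => (mem_localIntegralLevel_iff_of_smul_eq (IsCMField.complexConj L) 3 H' hc1 w hw g).trans Subgroup.mem_subgroupOf.symm
  have e1 := natCard_fixedCosets_eq (localNonsplitEquiv (IsCMField.complexConj L) H' hc1 w hw).toMulEquiv hK t'
  have e2 := natCard_fixedBy_cmLocalIntegralLevel_eq_of_congr L H' w hw ψ hlev t'
  have h1P := one_le_of_valued_sub_eq_exp_neg hd₁ hd₃ hP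
  have h1Q₁ := one_le_of_valued_sub_eq_exp_neg hd₁ hd₂ hQ₁
  have h1Q₂ := one_le_of_valued_sub_eq_exp_neg hd₃ hd₂ hQ₂
  refine ⟨Yv 0, Yv 1, Yv 2, t', hlit', ?_, ?_, ?_, ?_, ?_, ?_, hfin, ?_⟩
  · rw [hYvw]; exact hYn 0
  · rw [hYvw]; exact hYn 1
  · rw [hYvw]; exact hYn 2
  · rw [hYvw, hYvw, hYsub 0 2, hdϖ.vϖ, ← exp_neg_div_exp_neg_one h1P, ← hP]; rfl
  · rw [hYvw, hYvw, hYsub 0 1, hdϖ.vϖ, ← exp_neg_div_exp_neg_one h1Q₁, ← hQ₁]; rfl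
  · rw [hYvw, hYvw, hYsub 2 1, hdϖ.vϖ, ← exp_neg_div_exp_neg_one h1Q₂, ← hQ₂]; rfl
  · rw [h0]
    exact e1.symm.trans e2

end Core

end Literature.NumberTheory.Rogawski1990

end
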